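import Summits.NavierStokesRegularity.NavierStokesRegularity.Theses.PlaneEnergyCeiling
import Summits.NavierStokesRegularity.NavierStokesRegularity.Theorems.LiouvilleConjectureNS
import Summits.NavierStokesRegularity.NavierStokesRegularity.Theorems.PlanarEnergyLiouville.Negative.PlanarBoundLoadBearing
import HarnessLib

/-!
# Route PlaneEnergyCeiling · crux `PlanarEnergyLiouville` ⇐ the KNSS Liouville conjecture (L)

Theorems file for the crux item stmt-NavierStokesRegularity-16856
(`Theses.PlaneEnergyCeiling.PlanarEnergyLiouville`, rank 3 of route `PlaneEnergyCeiling`):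
a CONDITIONAL proof of the crux from the open conjecture
`Summit.NavierStokesRegularity.NavierStokesRegularity.LiouvilleConjectureNS` (KNSS 2009 (L):
every bounded ancient mild solution with measurable slices is slice-wise a.e. constant).

Argument (the refuter's §4 of `Cruxes/PlanarEnergyLiouville/Disproof.lean`, stated positively; the two
elementary lemmas are reused from `Theorems/PlanarEnergyLiouville/Negative/PlanarBoundLoadBearing.lean`):
under (L) the slice `v t` is a.e. equal to a constant `b`; a jointly smooth field has continuous
slices, so `v t = b` everywhere; and a nonzero constant has infinite planar kinetic energy
(`∫⁻ over ℝ² of ‖b‖ₑ² = ⊤`, Lebesgue measure of the plane is infinite), contradicting the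
planar bound — hence `b = 0`. So the crux sits inside the (L)-circle of open problems (it is
implied by (L); the converse is not claimed).
-/

noncomputable section

set_option linter.dupNamespace false -- nested layout Summit.<S>.<Sub>, Sub = S (D-0017)

open MeasureTheory Set Function Filter
open _root_.Topology
open scoped ENNReal
open Literature.Analysis.FluidPDE

namespace Summit.NavierStokesRegularity.NavierStokesRegularity.Theorems.PlaneEnergyCeilingPlanarEnergyLiouville

open Summit.NavierStokesRegularity.NavierStokesRegularity.Theorems.PlanarEnergyLiouvilleNegative
  (continuous_slice_of_contDiffOn lintegral_enorm_sq_const_eq_top)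

-- adapted from Cruxes/PlanarEnergyLiouville/Disproof.lean §4 (refuter-rattack-stmt-NavierStokesRegularity-16856-0)
/-- **The crux `PlanarEnergyLiouville` follows from the KNSS Liouville conjecture (L)**
(conditional result; KNSS 2009 §1 / Seregin–Šverák 2009 for (L)). Under (L) each slice `v t`,
`t < 0`, of a bounded ancient mild solution with measurable slices is a.e. a constant `b`; being
continuous (joint smoothness) it equals `b` everywhere; the planar bound on the plane `{x₂ = 0}`
then forces `b = 0`, since a nonzero constant has infinite planar energy.
[cite: KochNadirashviliSereginSverak2009, §1] -/
theorem planarEnergyLiouville_of_liouvilleConjectureNS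
    (hL : Summit.NavierStokesRegularity.NavierStokesRegularity.LiouvilleConjectureNS) :
    Summit.NavierStokesRegularity.NavierStokesRegularity.Theses.PlaneEnergyCeiling.PlanarEnergyLiouville := by
  intro v hv hmeas hsm hpl t ht x
  obtain ⟨b, hb⟩ := hL v hv hmeas t ht
  have hcont : Continuous (v t) := continuous_slice_of_contDiffOn hsm ht
  have heq : v t = fun _ => b := (Continuous.ae_eq_iff_eq volume hcont continuous_const).1 hb
  by_contra hx
  have hb0 : b ≠ 0 := by
    intro hb0
    apply hx
    rw [heq, hb0]
  obtain ⟨M, hM⟩ := hpl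
  have hle := hM t ht (LinearIsometryEquiv.refl ℝ (EuclideanSpace ℝ (Fin 3))) 0
  simp only [heq] at hle
  rw [lintegral_enorm_sq_const_eq_top hb0] at hle
  exact ENNReal.ofReal_ne_top (top_le_iff.1 hle)

end Summit.NavierStokesRegularity.NavierStokesRegularity.Theorems.PlaneEnergyCeilingPlanarEnergyLiouville

end
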